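import Mathlib
import HarnessLib

/-!
# Route `ColdStartUniversality` (fixed-cut-off SZZ dynamics, sampler package): the BERNSTEIN–BENNETT MECHANISM in elementary form —
# bounded increments ORTHOGONAL TO THE PAST with a CONDITIONAL-VARIANCE BOUND have variance-sensitive exponential tails

Helper file (seat `ym-line-csu-p1`, g35; `--supports stmt-QuantumFields-24809`).  Generic probability, no SZZ object: the variance-sensitive
refinement of the Azuma–Hoeffding mechanism of file 68.  On ANY probability space let `D₀, D₁, …` be real random variables with `|D_k| ≤ B`,
`ℱ_k` sub-σ-algebras with `S_k = Σ_(j<k) D_j` `ℱ_k`-measurable, and suppose that for every `k < n` and every bounded non-negative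
`ℱ_k`-measurable weight `Z`
  (orthogonality)            `E[Z·D_k] = 0`,
  (conditional variance)     `E[Z·D_k²] ≤ v·E[Z]`.
Then for every `λ ≥ 0` (third-order Taylor expansion `e^x ≤ 1 + x + x²(1/2 + |x|e^|x|)`, no conditional expectations):
* `exp_mul_le_taylor_three` — `e^(λd) ≤ 1 + λd + λ²d²(1/2 + λB e^(λB))` for `|d| ≤ B`;
* ★ `integral_mul_exp_mul_le_of_condVariance` — ONE BENNETT STEP `E[Z e^(λD)] ≤ exp(λ²v(1/2 + λBe^(λB)))·E[Z]`;
* ★★ `integral_exp_mul_sum_le_of_condVariance` — `E e^(λS_n) ≤ exp(n λ² v (1/2 + λBe^(λB)))`;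
* ★★ `measureReal_sum_ge_le_of_condVariance` — `P[S_n ≥ r] ≤ exp(−λr + nλ²v(1/2 + λBe^(λB)))`, and with `λ = r/(nv)`
  ★★ `measureReal_sum_ge_le_bernstein` — `P[S_n ≥ r] ≤ exp(−(r²/(2nv))·(1 − 2(rB/(nv))e^(rB/(nv))))`: the GAUSSIAN rate `r²/(2nv)` with the
  TRUE variance proxy `nv`, up to a correction that vanishes as `rB/(nv) → 0` (Bernstein/Bennett regime).
In the application (next file) `v` is the Green–Kubo variance per block, so the exponential rate of the cold-start sampler's deviations is governed
by the asymptotic variance `σ²(G)` — the constant the central limit theorem says is optimal.  THEOREMS ONLY, no definition, no sorry; [folklore]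
(Bernstein 1924, Bennett 1962, Freedman 1975; for Markov processes Lezaud 1998).  HONEST FRAMING: plumbing for fixed-cut-off sampler statements;
`UniformColdStartMixing` (24809) is NOT restated; no crux, rung or summit statement is proved; the Yang–Mills mass gap is NOT proved.
-/

set_option autoImplicit false

noncomputable section

namespace Summit.QuantumFields.YangMills.Theorems.ColdStartUniversality

open MeasureTheory ProbabilityTheory Filter Finset
open scoped NNReal ENNReal BigOperators

/-! ## §1. The pointwise Taylor bound -/

/-- `e^x ≤ 1 + x + x²·(1/2 + |x|e^|x|)` for every real `x`. [folklore] -/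
theorem exp_le_taylor_three (x : ℝ) : Real.exp x ≤ 1 + x + x ^ 2 * (1 / 2 + |x| * Real.exp |x|) := by
  have h := Complex.norm_exp_sub_sum_le_norm_mul_exp (x : ℂ) 3
  have hsum : ∑ m ∈ Finset.range 3, (x : ℂ) ^ m / (m.factorial : ℂ) = ((1 + x + x ^ 2 / 2 : ℝ) : ℂ) := by
    simp only [Finset.sum_range_succ, Finset.sum_range_zero, Nat.factorial, pow_zero, pow_one]
    push_cast; ring
  rw [hsum, ← Complex.ofReal_exp, ← Complex.ofReal_sub, Complex.norm_real, Complex.norm_real, Real.norm_eq_abs,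
    Real.norm_eq_abs] at h
  have h1 := le_abs_self (Real.exp x - (1 + x + x ^ 2 / 2))
  have h2 : |x| ^ 3 * Real.exp |x| = x ^ 2 * (|x| * Real.exp |x|) := by rw [pow_succ, sq_abs]; ring
  nlinarith [h1, h, h2]

/-- For `λ ≥ 0` and `|d| ≤ B`: `e^(λd) ≤ 1 + λd + λ²d²(1/2 + λB e^(λB))`. [folklore] -/
theorem exp_mul_le_taylor_three {B d l : ℝ} (hl : 0 ≤ l) (hd : |d| ≤ B) :
    Real.exp (l * d) ≤ 1 + l * d + l ^ 2 * d ^ 2 * (1 / 2 + l * B * Real.exp (l * B)) := by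
  have h := exp_le_taylor_three (l * d)
  have hx : |l * d| ≤ l * B := by rw [abs_mul, abs_of_nonneg hl]; exact mul_le_mul_of_nonneg_left hd hl
  have h2 : |l * d| * Real.exp |l * d| ≤ l * B * Real.exp (l * B) :=
    mul_le_mul hx (Real.exp_le_exp.2 hx) (Real.exp_pos _).le ((abs_nonneg _).trans hx)
  calc Real.exp (l * d) ≤ 1 + l * d + (l * d) ^ 2 * (1 / 2 + |l * d| * Real.exp |l * d|) := h
    _ ≤ 1 + l * d + (l * d) ^ 2 * (1 / 2 + l * B * Real.exp (l * B)) := by gcongr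
    _ = 1 + l * d + l ^ 2 * d ^ 2 * (1 / 2 + l * B * Real.exp (l * B)) := by ring

/-! ## §2. One Bennett step with an orthogonal weight and a conditional-variance bound -/

variable {Ω : Type*} [MeasurableSpace Ω] {P : Measure Ω}

/-- ★ **One Bennett step.**  On a finite measure space, let `Z ≥ 0` be bounded measurable, `D` measurable with `|D| ≤ B`, `∫ Z·D = 0` and
`∫ Z·D² ≤ v ∫ Z`.  Then for every `λ ≥ 0`: `∫ Z·e^(λD) ≤ exp(λ²v(1/2 + λBe^(λB))) · ∫ Z`. [folklore] -/
theorem integral_mul_exp_mul_le_of_condVariance [IsFiniteMeasure P] {Z D : Ω → ℝ}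
    (hZm : Measurable Z) (hDm : Measurable D) {CZ B v : ℝ} (hZ0 : ∀ ω, 0 ≤ Z ω) (hZb : ∀ ω, Z ω ≤ CZ)
    (hB : 0 ≤ B) (hDb : ∀ ω, |D ω| ≤ B) (horth : ∫ ω, Z ω * D ω ∂P = 0) (hvar : ∫ ω, Z ω * D ω ^ 2 ∂P ≤ v * ∫ ω, Z ω ∂P)
    {l : ℝ} (hl : 0 ≤ l) :
    ∫ ω, Z ω * Real.exp (l * D ω) ∂P ≤ Real.exp (l ^ 2 * v * (1 / 2 + l * B * Real.exp (l * B))) * ∫ ω, Z ω ∂P := by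
  have hbdd : ∀ {φ : Ω → ℝ} {C : ℝ}, Measurable φ → (∀ ω, |φ ω| ≤ C) → Integrable (fun ω => Z ω * φ ω) P :=
    fun {φ C} hφ hφb => (integrable_const (CZ * C)).mono' (hZm.mul hφ).aestronglyMeasurable
      (Eventually.of_forall fun ω => by
        rw [norm_mul, Real.norm_eq_abs, Real.norm_eq_abs, abs_of_nonneg (hZ0 ω)]
        exact mul_le_mul (hZb ω) (hφb ω) (abs_nonneg _) ((hZ0 ω).trans (hZb ω)))
  have hZi : Integrable Z P := by
    have h := hbdd (measurable_const (a := (1 : ℝ))) (fun _ => (abs_one.le : |(1 : ℝ)| ≤ 1))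
    simpa using h
  have hZDi : Integrable (fun ω => Z ω * D ω) P := hbdd hDm hDb
  have hD2b : ∀ ω, |D ω ^ 2| ≤ B ^ 2 := fun ω => by
    rw [abs_of_nonneg (sq_nonneg _), ← sq_abs]; exact pow_le_pow_left₀ (abs_nonneg _) (hDb ω) 2
  have hZD2i : Integrable (fun ω => Z ω * D ω ^ 2) P := hbdd (hDm.pow_const 2) hD2b
  have hEb : ∀ ω, |Real.exp (l * D ω)| ≤ Real.exp (l * B) := fun ω => by
    rw [abs_of_pos (Real.exp_pos _), Real.exp_le_exp]
    calc l * D ω ≤ l * |D ω| := mul_le_mul_of_nonneg_left (le_abs_self _) hl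
      _ ≤ l * B := mul_le_mul_of_nonneg_left (hDb ω) hl
  have hZEi : Integrable (fun ω => Z ω * Real.exp (l * D ω)) P := hbdd ((hDm.const_mul l).exp) hEb
  set c : ℝ := 1 / 2 + l * B * Real.exp (l * B) with hc
  have hc0 : 0 ≤ c := by positivity
  -- pointwise Taylor bound weighted by `Z ≥ 0`
  have hpt : ∀ ω, Z ω * Real.exp (l * D ω) ≤ Z ω + l * (Z ω * D ω) + l ^ 2 * c * (Z ω * D ω ^ 2) := fun ω => by
    have h := mul_le_mul_of_nonneg_left (exp_mul_le_taylor_three hl (hDb ω)) (hZ0 ω)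
    calc Z ω * Real.exp (l * D ω) ≤ Z ω * (1 + l * D ω + l ^ 2 * D ω ^ 2 * (1 / 2 + l * B * Real.exp (l * B))) := h
      _ = Z ω + l * (Z ω * D ω) + l ^ 2 * c * (Z ω * D ω ^ 2) := by simp only [hc]; ring
  have hRi : Integrable (fun ω => Z ω + l * (Z ω * D ω) + l ^ 2 * c * (Z ω * D ω ^ 2)) P :=
    (hZi.add (hZDi.const_mul _)).add (hZD2i.const_mul _)
  have hEZ0 : 0 ≤ ∫ ω, Z ω ∂P := integral_nonneg hZ0
  calc ∫ ω, Z ω * Real.exp (l * D ω) ∂P ≤ ∫ ω, (Z ω + l * (Z ω * D ω) + l ^ 2 * c * (Z ω * D ω ^ 2)) ∂P := integral_mono hZEi hRi hpt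
    _ = (∫ ω, Z ω ∂P) + l * (∫ ω, Z ω * D ω ∂P) + l ^ 2 * c * ∫ ω, Z ω * D ω ^ 2 ∂P := by
        have i12 : Integrable (fun ω => Z ω + l * (Z ω * D ω)) P := hZi.add (hZDi.const_mul _)
        rw [integral_add i12 (hZD2i.const_mul _), integral_add hZi (hZDi.const_mul _), integral_const_mul, integral_const_mul]
    _ ≤ (∫ ω, Z ω ∂P) + 0 + l ^ 2 * c * (v * ∫ ω, Z ω ∂P) := by
        rw [horth, mul_zero]
        exact add_le_add le_rfl (mul_le_mul_of_nonneg_left hvar (by positivity))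
    _ = (1 + l ^ 2 * v * c) * ∫ ω, Z ω ∂P := by ring
    _ ≤ Real.exp (l ^ 2 * v * c) * ∫ ω, Z ω ∂P := by
        refine mul_le_mul_of_nonneg_right ?_ hEZ0
        have := Real.add_one_le_exp (l ^ 2 * v * c)
        linarith

/-! ## §3. Sums: moment generating function and tails -/

/-- ★★ **Moment generating function of a sum of orthogonal bounded increments with conditional variance `≤ v`.**  On a probability space let
`D₀, D₁, …` be measurable with `|D_k| ≤ B`, `ℱ_k` sub-σ-algebras making `S_k = Σ_(j<k) D_j` measurable, and for `k < n` and every bounded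
non-negative `ℱ_k`-measurable `Z`: `∫ Z D_k = 0` and `∫ Z D_k² ≤ v ∫ Z`.  Then `∫ e^(λS_n) ≤ exp(nλ²v(1/2 + λBe^(λB)))` for every `λ ≥ 0`.
[folklore] -/
theorem integral_exp_mul_sum_le_of_condVariance [IsProbabilityMeasure P] (ℱ : ℕ → MeasurableSpace Ω) (hℱ : ∀ k, ℱ k ≤ ‹MeasurableSpace Ω›)
    (D : ℕ → Ω → ℝ) (hDm : ∀ k, Measurable (D k)) {B v : ℝ} (hB : 0 ≤ B) (hDb : ∀ k ω, |D k ω| ≤ B)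
    (hSF : ∀ k, Measurable[ℱ k] fun ω => ∑ j ∈ Finset.range k, D j ω) (n : ℕ)
    (horth : ∀ k < n, ∀ Z : Ω → ℝ, Measurable[ℱ k] Z → (∀ ω, 0 ≤ Z ω) → (∃ C : ℝ, ∀ ω, Z ω ≤ C) →
      ∫ ω, Z ω * D k ω ∂P = 0)
    (hvar : ∀ k < n, ∀ Z : Ω → ℝ, Measurable[ℱ k] Z → (∀ ω, 0 ≤ Z ω) → (∃ C : ℝ, ∀ ω, Z ω ≤ C) →
      ∫ ω, Z ω * D k ω ^ 2 ∂P ≤ v * ∫ ω, Z ω ∂P)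
    {l : ℝ} (hl : 0 ≤ l) :
    ∫ ω, Real.exp (l * ∑ j ∈ Finset.range n, D j ω) ∂P ≤ Real.exp (n * (l ^ 2 * v * (1 / 2 + l * B * Real.exp (l * B)))) := by
  induction n with
  | zero => simp
  | succ n ih =>
    have ih' := ih (fun k hk => horth k (Nat.lt_succ_of_lt hk)) (fun k hk => hvar k (Nat.lt_succ_of_lt hk))
    set Z : Ω → ℝ := fun ω => Real.exp (l * ∑ j ∈ Finset.range n, D j ω) with hZ
    have hZF : Measurable[ℱ n] Z := ((hSF n).const_mul l).exp
    have hZm : Measurable Z := hZF.mono (hℱ n) le_rfl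
    have hSb : ∀ ω, |∑ j ∈ Finset.range n, D j ω| ≤ n * B := fun ω =>
      (Finset.abs_sum_le_sum_abs _ _).trans (by
        calc ∑ j ∈ Finset.range n, |D j ω| ≤ ∑ _j ∈ Finset.range n, B := Finset.sum_le_sum fun j _ => hDb j ω
          _ = n * B := by rw [Finset.sum_const, Finset.card_range, nsmul_eq_mul])
    have hZb : ∀ ω, Z ω ≤ Real.exp (l * (n * B)) := fun ω => by
      simp only [hZ, Real.exp_le_exp]
      calc l * ∑ j ∈ Finset.range n, D j ω ≤ l * |∑ j ∈ Finset.range n, D j ω| := mul_le_mul_of_nonneg_left (le_abs_self _) hl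
        _ ≤ l * (n * B) := mul_le_mul_of_nonneg_left (hSb ω) hl
    have hZ0 : ∀ ω, 0 ≤ Z ω := fun ω => (Real.exp_pos _).le
    have step := integral_mul_exp_mul_le_of_condVariance hZm (hDm n) hZ0 hZb hB (hDb n)
      (horth n (Nat.lt_succ_self n) Z hZF hZ0 ⟨_, hZb⟩) (hvar n (Nat.lt_succ_self n) Z hZF hZ0 ⟨_, hZb⟩) hl
    have heq : ∀ ω, Real.exp (l * ∑ j ∈ Finset.range (n + 1), D j ω) = Z ω * Real.exp (l * D n ω) := fun ω => by
      rw [Finset.sum_range_succ, mul_add, Real.exp_add]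
    rw [integral_congr_ae (ae_of_all _ heq)]
    calc ∫ ω, Z ω * Real.exp (l * D n ω) ∂P ≤ Real.exp (l ^ 2 * v * (1 / 2 + l * B * Real.exp (l * B))) * ∫ ω, Z ω ∂P := step
      _ ≤ Real.exp (l ^ 2 * v * (1 / 2 + l * B * Real.exp (l * B))) * Real.exp (n * (l ^ 2 * v * (1 / 2 + l * B * Real.exp (l * B)))) :=
          mul_le_mul_of_nonneg_left ih' (Real.exp_pos _).le
      _ = Real.exp (↑(n + 1) * (l ^ 2 * v * (1 / 2 + l * B * Real.exp (l * B)))) := by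
          rw [← Real.exp_add]; push_cast; ring_nf

/-- ★★ **Bennett–Bernstein tail (Chernoff form)**: under the hypotheses of `integral_exp_mul_sum_le_of_condVariance`, for every `λ ≥ 0` and real `r`,
`P[S_n ≥ r] ≤ exp(−λr + nλ²v(1/2 + λBe^(λB)))`. [folklore] -/
theorem measureReal_sum_ge_le_of_condVariance [IsProbabilityMeasure P] (ℱ : ℕ → MeasurableSpace Ω) (hℱ : ∀ k, ℱ k ≤ ‹MeasurableSpace Ω›)
    (D : ℕ → Ω → ℝ) (hDm : ∀ k, Measurable (D k)) {B v : ℝ} (hB : 0 ≤ B) (hDb : ∀ k ω, |D k ω| ≤ B)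
    (hSF : ∀ k, Measurable[ℱ k] fun ω => ∑ j ∈ Finset.range k, D j ω) (n : ℕ)
    (horth : ∀ k < n, ∀ Z : Ω → ℝ, Measurable[ℱ k] Z → (∀ ω, 0 ≤ Z ω) → (∃ C : ℝ, ∀ ω, Z ω ≤ C) →
      ∫ ω, Z ω * D k ω ∂P = 0)
    (hvar : ∀ k < n, ∀ Z : Ω → ℝ, Measurable[ℱ k] Z → (∀ ω, 0 ≤ Z ω) → (∃ C : ℝ, ∀ ω, Z ω ≤ C) →
      ∫ ω, Z ω * D k ω ^ 2 ∂P ≤ v * ∫ ω, Z ω ∂P)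
    {l : ℝ} (hl : 0 ≤ l) (r : ℝ) :
    P.real {ω | r ≤ ∑ j ∈ Finset.range n, D j ω} ≤ Real.exp (-l * r + n * (l ^ 2 * v * (1 / 2 + l * B * Real.exp (l * B)))) := by
  have hSm : Measurable fun ω => ∑ j ∈ Finset.range n, D j ω := (hSF n).mono (hℱ n) le_rfl
  have hSb : ∀ ω, |∑ j ∈ Finset.range n, D j ω| ≤ n * B := fun ω =>
    (Finset.abs_sum_le_sum_abs _ _).trans (by
      calc ∑ j ∈ Finset.range n, |D j ω| ≤ ∑ _j ∈ Finset.range n, B := Finset.sum_le_sum fun j _ => hDb j ω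
        _ = n * B := by rw [Finset.sum_const, Finset.card_range, nsmul_eq_mul])
  have hint : Integrable (fun ω => Real.exp (l * ∑ j ∈ Finset.range n, D j ω)) P :=
    (integrable_const (Real.exp (l * (n * B)))).mono' (hSm.const_mul l).exp.aestronglyMeasurable
      (Eventually.of_forall fun ω => by
        rw [Real.norm_eq_abs, abs_of_pos (Real.exp_pos _), Real.exp_le_exp]
        calc l * ∑ j ∈ Finset.range n, D j ω ≤ l * |∑ j ∈ Finset.range n, D j ω| := mul_le_mul_of_nonneg_left (le_abs_self _) hl
          _ ≤ l * (n * B) := mul_le_mul_of_nonneg_left (hSb ω) hl)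
  have h1 := measure_ge_le_exp_mul_mgf (μ := P) (X := fun ω => ∑ j ∈ Finset.range n, D j ω) r hl hint
  have h2 := integral_exp_mul_sum_le_of_condVariance ℱ hℱ D hDm hB hDb hSF n horth hvar hl
  rw [mgf] at h1
  calc P.real {ω | r ≤ ∑ j ∈ Finset.range n, D j ω} ≤ Real.exp (-l * r) * ∫ ω, Real.exp (l * ∑ j ∈ Finset.range n, D j ω) ∂P := h1
    _ ≤ Real.exp (-l * r) * Real.exp (n * (l ^ 2 * v * (1 / 2 + l * B * Real.exp (l * B)))) :=
        mul_le_mul_of_nonneg_left h2 (Real.exp_pos _).le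
    _ = Real.exp (-l * r + n * (l ^ 2 * v * (1 / 2 + l * B * Real.exp (l * B)))) := by rw [← Real.exp_add]

/-- ★★ **Bernstein tail with the true variance proxy.**  Under the same hypotheses with `v > 0`, `n ≥ 1` and `r ≥ 0`, the choice `λ = r/(nv)` gives
`P[S_n ≥ r] ≤ exp(−(r²/(2nv))·(1 − 2·(rB/(nv))·e^(rB/(nv))))` — the Gaussian rate `r²/(2nv)` up to a factor `→ 1` as `rB/(nv) → 0`. [folklore] -/
theorem measureReal_sum_ge_le_bernstein [IsProbabilityMeasure P] (ℱ : ℕ → MeasurableSpace Ω) (hℱ : ∀ k, ℱ k ≤ ‹MeasurableSpace Ω›)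
    (D : ℕ → Ω → ℝ) (hDm : ∀ k, Measurable (D k)) {B v : ℝ} (hB : 0 ≤ B) (hv : 0 < v) (hDb : ∀ k ω, |D k ω| ≤ B)
    (hSF : ∀ k, Measurable[ℱ k] fun ω => ∑ j ∈ Finset.range k, D j ω) {n : ℕ} (hn : 1 ≤ n)
    (horth : ∀ k < n, ∀ Z : Ω → ℝ, Measurable[ℱ k] Z → (∀ ω, 0 ≤ Z ω) → (∃ C : ℝ, ∀ ω, Z ω ≤ C) →
      ∫ ω, Z ω * D k ω ∂P = 0)
    (hvar : ∀ k < n, ∀ Z : Ω → ℝ, Measurable[ℱ k] Z → (∀ ω, 0 ≤ Z ω) → (∃ C : ℝ, ∀ ω, Z ω ≤ C) →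
      ∫ ω, Z ω * D k ω ^ 2 ∂P ≤ v * ∫ ω, Z ω ∂P)
    {r : ℝ} (hr : 0 ≤ r) :
    P.real {ω | r ≤ ∑ j ∈ Finset.range n, D j ω} ≤
      Real.exp (-(r ^ 2 / (2 * (n * v))) * (1 - 2 * (r * B / (n * v)) * Real.exp (r * B / (n * v)))) := by
  have hnr : (0 : ℝ) < n := by exact_mod_cast hn
  have hnv : 0 < (n : ℝ) * v := mul_pos hnr hv
  have hl : 0 ≤ r / (n * v) := div_nonneg hr hnv.le
  have h := measureReal_sum_ge_le_of_condVariance ℱ hℱ D hDm hB hDb hSF n horth hvar hl r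
  refine h.trans (le_of_eq ?_)
  congr 1
  have hlB : r / (n * v) * B = r * B / (n * v) := by ring
  rw [hlB]
  field_simp
  ring

end Summit.QuantumFields.YangMills.Theorems.ColdStartUniversality

end
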